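/-
Copyright: the b2b-balaban T⁴-continuum CRUX team, row NE7b, leaf lineage `t4-ne7b-formalise-leaf-02` (gen 128). Project licence.
-/
import Summits.QuantumFields.BalabanUV.T4Continuum.Spine.NE7b.ConvexWindowSuppliersBox

/-!
# THE MIXED CONSTANT OF A LOCAL PERTURBATION IS INTENSIVE: `‖D³P(z)[w,·,·]‖_op ≤ M·‖w‖_∞` with `M` a per-coordinate FIBRE SUM of the
# third-derivative entries — a Schur row∕column test in the standard basis, and the locality count `M ≤ ν·τ` (row NE7b, node U5c;
# letter (ℓ1) of the windowed road, the by-value half of the refuter's κ-ne7bref-g72-4: «`c₃^{(∞)}` intensive for a local `P`»)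

Cell `pub-balaban`, sub-cell `t4`, spine estimate NE7b (`T4WeightBudget.RelWeightBound`; the cell's OWN estimate — NOT PRINTED in
[Bałaban 1983–89], NOT PROVED).  Crux-route work under `Spine/NE7b/` by the row's E-side ∕ key-readings leaf lineage; NOTHING of
Bałaban's is named or asserted; no `T4Continuum/Support` leaf typed; no `def`; zero `sorry`.

WHY.  `…NE7b.ConvexWindowSuppliersBox` (this lineage) supplies the road's modulus `2σ − (‖D²P(x₀)‖ + c·ρ)` on a window read by any size
reading `N` from the letter `‖D³P(z)[w,·,·]‖_op ≤ c·N(w)` — the located cure of the `√n` (refuter κ-ne7bref-g72-4).  The cure pays because `c` is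
INTENSIVE for a LOCAL perturbation («in the toy `= 6c`», «each direction meeting O(1) plaquettes», PRICING-NE7b v86 F453): the third derivative of
a sum of plaquette terms has entries that vanish unless the three coordinates share an interaction, so through each coordinate (or bond block)
only a LATTICE-GEOMETRIC number `ν` of index triples is live, and `c ≤ ν·τ` with `τ` the largest entry.  This is the desk's own by-value road
(v89 F463 ∕ ρ-ne7bref-g74-1 on idea-1's T-71: «by the block Schur test `c_p ≤ 3√3` and, each bond lying in `2(d−1) = 6` plaquettes,
`c_latt ≤ 6·3√3`»).  THIS FILE types it: a Schur row∕column test for a trilinear form — in the standard basis (§2, sup norm on the first slot) and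
over a BLOCK decomposition of the identity (§5, block sup norm on the first slot, the desk's form exactly) — plus the locality count, and the
junctions BY NAME with `…ConvexWindowSuppliersBox`.  (The third-derivative road carries the higher-order terms inside `c`; no truncation.)

WHAT IS PROVED ([folklore] multilinear algebra + Cauchy–Schwarz on `E = EuclideanSpace ℝ (Fin n)`; index triples are functions
`r : Fin 3 → Fin n`, the fibre of `r ↦ r s` over `j` is «all triples whose `s`-th index is `j`»; `e_i = EuclideanSpace.single i 1`):
* §1 `apply_eq_sum_coords` (a `k`-linear form in the standard basis: `f m = Σ_{r : Fin k → Fin n} (∏_s m_s(r_s))·f(e_{r 0}, …, e_{r (k−1)})`).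
* §2 `sum_mul_mul_le_of_sq_sums` (the Cauchy–Schwarz step), `sum_mul_sq_le_of_fibreSum` and the Schur bound **`abs_apply_three_le_of_fibreSums`**:
  fibre sums of `|f(e_{r0}, e_{r1}, e_{r2})|` over the middle and over the last index `≤ M` ⟹ `|f(w, u, v)| ≤ M·‖w‖_∞·‖u‖·‖v‖`.
* §3 the locality count `fibreSum_le_of_local`: entries supported in an interaction set `N` with `|T| ≤ τ` on `N` and at most `ν` triples of
  `N` through each value of the `s`-th index ⟹ every fibre sum `≤ ν·τ` — `ν` is a count of the interaction pattern, not of the volume.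
* §4 junctions BY NAME with `…ConvexWindowSuppliersBox`: **`thirdDeriv_supNorm_of_fibreSums`** (fibre sums of `|D³P(z)[e_i,e_j,e_k]|` ON `K`
  `≤ M` ⟹ the mixed letter with `c∞ = M`), `thirdDeriv_supNorm_of_local` (`c∞ = ν·τ`), and the ENDs
  **`firstOrderOn_quadratic_add_of_fibreSums`** (box window, centre `0`: modulus `2σ − (‖D²P(0)‖ + M·ρ∞)`) and
  `firstOrderOn_quadratic_add_of_local_subspace_inter_coordBox` (the model window `L ∩ box(x₀, a)`: modulus `2σ − (‖D²P(x₀)‖ + ν·τ·a)` —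
  every structural hypothesis discharged, the displayed numbers are `σ`, the entry bound `τ`, the interaction count `ν`, the half-width `a`).
* §5 BLOCK FORM (the desk's shape exactly): `apply_eq_sum_blocks` (expansion over a decomposition of the identity `Σ_b Q_b = id`),
  `sum_mul_normSq_le_of_blockFibreSum`, **`abs_apply_three_le_of_blockFibreSums`** (the BLOCK Schur test: idempotents `Q_b` with Pythagoras,
  block entries `‖f ∘ (Q_{r0}, Q_{r1}, Q_{r2})‖_op`, fibre sums over the middle ∕ last block `≤ M`, any reading `N` dominating the block norms
  ⟹ `|f(w,u,v)| ≤ M·N(w)·‖u‖·‖v‖`), `thirdDeriv_reading_of_blockFibreSums` (the `N`-letter, `c = M`), the END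
  `firstOrderOn_quadratic_add_of_blockFibreSums` (window read by `N`, any centre: modulus `2σ − (‖D²P(x₀)‖ + M·ρ)`) and
  **`firstOrderOn_quadratic_add_of_blockFibreSums_blockWindow`** (T-61's window `L ∩ ⋂_b {‖Q_b y‖ ≤ a}` VERBATIM: modulus `2σ − (‖D²P(0)‖ + M·a)`,
  `a` the PER-BOND radius, `M` of the shape «plaquettes per bond × block row constant» — the desk's `6·3√3` for the Wilson cubic).

NOT HERE (honest): the interaction set, `ν`, `τ`, `M`, `σ`, `a` for Bałaban's steps — (A3) ∕ (A1c) readings of print's effective action on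
its small-field window, displayed by the consumer and valued by the desk, not proved here; anything of Bałaban's.  NE7b NOT PRINTED ∕ NOT
PROVED; spine PROVED 0∕9; rung (B)+1 on a FINITE torus — NOT infinite volume, NOT the mass gap, NOT Clay.
HONEST DEPENDENCY: continuum YM on T⁴ ⇐ BetaPertH ∧ nine spine estimates (0/9 proved); BetaPertH ⇐ (D1) ∧ (D4) ∧ CAP+tail.
-/

set_option autoImplicit false

noncomputable section

open Real InnerProductSpace Set Metric Finset
open scoped RealInnerProductSpace Gradient
open Summit.QuantumFields.BalabanUV.T4Continuum.NE7b.ConvexWindowSuppliersBox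

namespace Summit.QuantumFields.BalabanUV.T4Continuum.NE7b.ConvexWindowSuppliersLocal

variable {n : ℕ}

/-! ## §1 Coordinate expansion of a multilinear form in the standard basis -/

/-- **A `k`-LINEAR FORM IN COORDINATES**: `f m = Σ_{r : Fin k → Fin n} (∏_s m_s (r s)) · f (e_{r 0}, …, e_{r (k−1)})` with `e_i` the standard
basis of `EuclideanSpace ℝ (Fin n)` (expand every slot in the orthonormal basis, multilinearity). [folklore] -/
theorem apply_eq_sum_coords {k : ℕ}
    (f : ContinuousMultilinearMap ℝ (fun _ : Fin k => EuclideanSpace ℝ (Fin n)) ℝ)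
    (m : Fin k → EuclideanSpace ℝ (Fin n)) :
    f m = ∑ r : Fin k → Fin n, (∏ s, m s (r s)) * f (fun s => EuclideanSpace.single (r s) (1 : ℝ)) := by
  classical
  have hm : m = fun s => ∑ j : Fin n, (m s j) • EuclideanSpace.single j (1 : ℝ) := by
    funext s
    conv_lhs => rw [← (EuclideanSpace.basisFun (Fin n) ℝ).sum_repr (m s)]
    simp [EuclideanSpace.basisFun_apply, EuclideanSpace.basisFun_repr]
  conv_lhs => rw [hm]
  rw [f.map_sum]
  refine Finset.sum_congr rfl fun r _ => ?_
  exact (f.map_smul_univ (fun i => m i (r i)) (fun i => EuclideanSpace.single (r i) (1 : ℝ))).trans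
    (smul_eq_mul _ _)

/-! ## §2 The Schur row∕column test for a trilinear form, sup norm on the first slot -/

/-- **THE CAUCHY–SCHWARZ STEP OF THE SCHUR TEST**: nonnegative weights `t` and entries `a, b ≥ 0` with the weighted square sums bounded,
`Σ t·a² ≤ M·A²` and `Σ t·b² ≤ M·B²` (`M, A, B ≥ 0`) ⟹ `Σ t·a·b ≤ M·A·B` (write `t a b = (√t a)(√t b)`). [folklore] -/
theorem sum_mul_mul_le_of_sq_sums {ι : Type*} (S : Finset ι) (t a b : ι → ℝ) (ht : ∀ i, 0 ≤ t i) {M A B : ℝ}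
    (hM : 0 ≤ M) (hA : 0 ≤ A) (hB : 0 ≤ B) (ha : ∑ i ∈ S, t i * a i ^ 2 ≤ M * A ^ 2) (hb : ∑ i ∈ S, t i * b i ^ 2 ≤ M * B ^ 2) :
    ∑ i ∈ S, t i * a i * b i ≤ M * (A * B) := by
  have hcs := Real.sum_mul_le_sqrt_mul_sqrt S (fun i => √(t i) * a i) (fun i => √(t i) * b i)
  have hsq : ∀ (c : ι → ℝ) (i : ι), (√(t i) * c i) ^ 2 = t i * c i ^ 2 := fun c i => by rw [mul_pow, Real.sq_sqrt (ht i)]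
  simp_rw [hsq] at hcs
  calc ∑ i ∈ S, t i * a i * b i = ∑ i ∈ S, (√(t i) * a i) * (√(t i) * b i) :=
        Finset.sum_congr rfl fun i _ => by rw [mul_mul_mul_comm, Real.mul_self_sqrt (ht i), mul_assoc]
    _ ≤ √(∑ i ∈ S, t i * a i ^ 2) * √(∑ i ∈ S, t i * b i ^ 2) := hcs
    _ ≤ √(M * A ^ 2) * √(M * B ^ 2) :=
        mul_le_mul (Real.sqrt_le_sqrt ha) (Real.sqrt_le_sqrt hb) (Real.sqrt_nonneg _) (Real.sqrt_nonneg _)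
    _ = M * (A * B) := by
        rw [Real.sqrt_mul hM, Real.sqrt_mul hM, Real.sqrt_sq hA, Real.sqrt_sq hB, mul_mul_mul_comm, Real.mul_self_sqrt hM]

/-- **FIBRE SUMS CONTROL THE WEIGHTED SQUARE SUM**: if for every `j` the sum of `|T r|` over the triples `r` with `r s = j` is `≤ M`, then
`Σ_r |T r|·u(r s)² ≤ M·‖u‖²`. [folklore] -/
theorem sum_mul_sq_le_of_fibreSum (T : (Fin 3 → Fin n) → ℝ) (s : Fin 3) {M : ℝ}
    (hfib : ∀ j : Fin n, ∑ r ∈ univ.filter (fun r : Fin 3 → Fin n => r s = j), |T r| ≤ M)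
    (u : EuclideanSpace ℝ (Fin n)) :
    ∑ r : Fin 3 → Fin n, |T r| * u (r s) ^ 2 ≤ M * ‖u‖ ^ 2 := by
  classical
  rw [← Finset.sum_fiberwise univ (fun r : Fin 3 → Fin n => r s) (fun r => |T r| * u (r s) ^ 2)]
  rw [EuclideanSpace.norm_sq_eq, Finset.mul_sum]
  refine Finset.sum_le_sum fun j _ => ?_
  have hj : ∑ r ∈ univ.filter (fun r : Fin 3 → Fin n => r s = j), |T r| * u (r s) ^ 2
      = (∑ r ∈ univ.filter (fun r : Fin 3 → Fin n => r s = j), |T r|) * u j ^ 2 := by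
    rw [Finset.sum_mul]
    refine Finset.sum_congr rfl fun r hr => ?_
    rw [(Finset.mem_filter.1 hr).2]
  rw [hj, Real.norm_eq_abs, sq_abs]
  exact mul_le_mul_of_nonneg_right (hfib j) (sq_nonneg _)

/-- **THE SCHUR TEST, TRILINEAR, SUP NORM ON THE FIRST SLOT.**  Let `f` be a continuous trilinear form on `E` and
`T r := f(e_{r 0}, e_{r 1}, e_{r 2})` its entries.  If for every `j` the fibre sum `Σ_{r : r 1 = j} |T r| ≤ M` and for every `k` the fibre sum
`Σ_{r : r 2 = k} |T r| ≤ M` (`0 ≤ M`), then `|f(w, u, v)| ≤ M·‖w‖_∞·‖u‖·‖v‖` for all `w, u, v`: expand in coordinates, pull `|w_i| ≤ ‖w‖_∞` out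
of the first slot, and run Cauchy–Schwarz on `Σ_r |T r|·|u_{r1}|·|v_{r2}| = Σ_r (√|T r|·|u_{r1}|)(√|T r|·|v_{r2}|)`. [folklore] -/
theorem abs_apply_three_le_of_fibreSums
    (f : ContinuousMultilinearMap ℝ (fun _ : Fin 3 => EuclideanSpace ℝ (Fin n)) ℝ) {M : ℝ} (hM : 0 ≤ M)
    (hrow : ∀ j : Fin n, ∑ r ∈ univ.filter (fun r : Fin 3 → Fin n => r 1 = j),
      |f (fun s => EuclideanSpace.single (r s) (1 : ℝ))| ≤ M)
    (hcol : ∀ k : Fin n, ∑ r ∈ univ.filter (fun r : Fin 3 → Fin n => r 2 = k),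
      |f (fun s => EuclideanSpace.single (r s) (1 : ℝ))| ≤ M)
    (w u v : EuclideanSpace ℝ (Fin n)) :
    |f ![w, u, v]| ≤ M * ‖WithLp.ofLp w‖ * ‖u‖ * ‖v‖ := by
  classical
  set T : (Fin 3 → Fin n) → ℝ := fun r => f (fun s => EuclideanSpace.single (r s) (1 : ℝ)) with hT
  have hT0 : ∀ r, 0 ≤ |T r| := fun r => abs_nonneg _
  have hexp : f ![w, u, v] = ∑ r : Fin 3 → Fin n, (w (r 0) * u (r 1) * v (r 2)) * T r := by
    rw [apply_eq_sum_coords f ![w, u, v]]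
    exact Finset.sum_congr rfl fun r _ => by simp [Fin.prod_univ_three, hT]
  have hw : ∀ i, |w i| ≤ ‖WithLp.ofLp w‖ := fun i => abs_apply_le_supNorm w i
  have h1 : |f ![w, u, v]| ≤ ‖WithLp.ofLp w‖ * ∑ r : Fin 3 → Fin n, |T r| * |u (r 1)| * |v (r 2)| := by
    rw [hexp]
    calc |∑ r : Fin 3 → Fin n, (w (r 0) * u (r 1) * v (r 2)) * T r|
        ≤ ∑ r : Fin 3 → Fin n, |(w (r 0) * u (r 1) * v (r 2)) * T r| := Finset.abs_sum_le_sum_abs _ _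
      _ = ∑ r : Fin 3 → Fin n, |w (r 0)| * (|T r| * |u (r 1)| * |v (r 2)|) := by
          refine Finset.sum_congr rfl fun r _ => ?_
          rw [abs_mul, abs_mul, abs_mul]; ring
      _ ≤ ∑ r : Fin 3 → Fin n, ‖WithLp.ofLp w‖ * (|T r| * |u (r 1)| * |v (r 2)|) := by
          refine Finset.sum_le_sum fun r _ => ?_
          exact mul_le_mul_of_nonneg_right (hw (r 0)) (by positivity)
      _ = ‖WithLp.ofLp w‖ * ∑ r : Fin 3 → Fin n, |T r| * |u (r 1)| * |v (r 2)| := by rw [Finset.mul_sum]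
  have h2 : ∑ r : Fin 3 → Fin n, |T r| * |u (r 1)| * |v (r 2)| ≤ M * (‖u‖ * ‖v‖) :=
    sum_mul_mul_le_of_sq_sums _ _ _ _ hT0 hM (norm_nonneg _) (norm_nonneg _)
      (by simp_rw [sq_abs]; exact sum_mul_sq_le_of_fibreSum T 1 hrow u)
      (by simp_rw [sq_abs]; exact sum_mul_sq_le_of_fibreSum T 2 hcol v)
  calc |f ![w, u, v]| ≤ ‖WithLp.ofLp w‖ * ∑ r : Fin 3 → Fin n, |T r| * |u (r 1)| * |v (r 2)| := h1
    _ ≤ ‖WithLp.ofLp w‖ * (M * (‖u‖ * ‖v‖)) := mul_le_mul_of_nonneg_left h2 (norm_nonneg _)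
    _ = M * ‖WithLp.ofLp w‖ * ‖u‖ * ‖v‖ := by ring

/-! ## §3 The locality count: entries supported in an interaction set with bounded fibres -/

/-- **LOCALITY MAKES THE FIBRE SUMS INTENSIVE.**  If the entries `T` vanish off an interaction set `N` of index triples, `|T| ≤ τ` on `N`
(`0 ≤ τ`), and at most `ν` triples of `N` pass through each value `j` of the `s`-th index, then every fibre sum of `|T|` over `{r | r s = j}`
is `≤ ν·τ` — a count of the interaction pattern, independent of the number of coordinates `n`. [folklore] -/
theorem fibreSum_le_of_local (T : (Fin 3 → Fin n) → ℝ) (N : Finset (Fin 3 → Fin n)) {τ : ℝ} (hτ : 0 ≤ τ)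
    {ν : ℕ} (hsupp : ∀ r, r ∉ N → T r = 0) (hτb : ∀ r ∈ N, |T r| ≤ τ) (s : Fin 3) (j : Fin n)
    (hcard : (N.filter (fun r => r s = j)).card ≤ ν) :
    ∑ r ∈ univ.filter (fun r : Fin 3 → Fin n => r s = j), |T r| ≤ ν * τ := by
  classical
  have hsub : N.filter (fun r => r s = j) ⊆ univ.filter (fun r : Fin 3 → Fin n => r s = j) :=
    fun r hr => by simp only [Finset.mem_filter, Finset.mem_univ, true_and] at hr ⊢; exact hr.2
  rw [← Finset.sum_subset hsub (fun r hr hrN => ?_)]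
  · calc ∑ r ∈ N.filter (fun r => r s = j), |T r| ≤ ∑ _r ∈ N.filter (fun r => r s = j), τ :=
          Finset.sum_le_sum fun r hr => hτb r (Finset.mem_filter.1 hr).1
      _ = (N.filter (fun r => r s = j)).card * τ := by rw [Finset.sum_const, nsmul_eq_mul]
      _ ≤ ν * τ := mul_le_mul_of_nonneg_right (by exact_mod_cast hcard) hτ
  · have : r ∉ N := fun h => hrN (Finset.mem_filter.2 ⟨h, (Finset.mem_filter.1 hr).2⟩)
    simp [hsupp r this]

/-! ## §4 Junctions: the mixed letter and the convexity letter from fibre sums of the third-derivative entries -/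

/-- **THE MIXED LETTER FROM FIBRE SUMS OF THE ENTRIES** (`c∞ = M`).  If ON `K` the entries `D³P(z)[e_{r0}, e_{r1}, e_{r2}]` have fibre sums
over the middle and over the last index `≤ M` (`0 ≤ M`), then `‖D³P(z)[w,·,·]‖_op ≤ M·‖w‖_∞` for `z ∈ K` — the hypothesis of
`…ConvexWindowSuppliersBox` §1–§3 with an intensive constant. [folklore] -/
theorem thirdDeriv_supNorm_of_fibreSums {P : EuclideanSpace ℝ (Fin n) → ℝ} {M : ℝ} {K : Set (EuclideanSpace ℝ (Fin n))}
    (hM : 0 ≤ M)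
    (hrow : ∀ z ∈ K, ∀ j : Fin n, ∑ r ∈ univ.filter (fun r : Fin 3 → Fin n => r 1 = j),
      |iteratedFDeriv ℝ 3 P z (fun s => EuclideanSpace.single (r s) (1 : ℝ))| ≤ M)
    (hcol : ∀ z ∈ K, ∀ k : Fin n, ∑ r ∈ univ.filter (fun r : Fin 3 → Fin n => r 2 = k),
      |iteratedFDeriv ℝ 3 P z (fun s => EuclideanSpace.single (r s) (1 : ℝ))| ≤ M) :
    ∀ z ∈ K, ∀ w : EuclideanSpace ℝ (Fin n), ‖fderiv ℝ (iteratedFDeriv ℝ 2 P) z w‖ ≤ M * ‖WithLp.ofLp w‖ :=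
  thirdDeriv_supNorm_of_entries hM fun z hz w u v =>
    abs_apply_three_le_of_fibreSums (iteratedFDeriv ℝ 3 P z) hM (hrow z hz) (hcol z hz) w u v

/-- **THE MIXED LETTER OF A LOCAL PERTURBATION** (`c∞ = ν·τ`).  If ON `K` the entries of `D³P(z)` vanish off an interaction set `N`, are
bounded by `τ` on `N`, and at most `ν` triples of `N` pass through each middle index and through each last index, then
`‖D³P(z)[w,·,·]‖_op ≤ (ν·τ)·‖w‖_∞` for `z ∈ K`. [folklore] -/
theorem thirdDeriv_supNorm_of_local {P : EuclideanSpace ℝ (Fin n) → ℝ} {τ : ℝ} {ν : ℕ} {K : Set (EuclideanSpace ℝ (Fin n))}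
    (N : Finset (Fin 3 → Fin n)) (hτ : 0 ≤ τ)
    (hsupp : ∀ z ∈ K, ∀ r, r ∉ N → iteratedFDeriv ℝ 3 P z (fun s => EuclideanSpace.single (r s) (1 : ℝ)) = 0)
    (hτb : ∀ z ∈ K, ∀ r ∈ N, |iteratedFDeriv ℝ 3 P z (fun s => EuclideanSpace.single (r s) (1 : ℝ))| ≤ τ)
    (hrow : ∀ j : Fin n, (N.filter (fun r => r 1 = j)).card ≤ ν)
    (hcol : ∀ k : Fin n, (N.filter (fun r => r 2 = k)).card ≤ ν) :
    ∀ z ∈ K, ∀ w : EuclideanSpace ℝ (Fin n), ‖fderiv ℝ (iteratedFDeriv ℝ 2 P) z w‖ ≤ (ν * τ) * ‖WithLp.ofLp w‖ :=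
  thirdDeriv_supNorm_of_fibreSums (by positivity)
    (fun z hz j => fibreSum_le_of_local _ N hτ (hsupp z hz) (hτb z hz) 1 j (hrow j))
    (fun z hz k => fibreSum_le_of_local _ N hτ (hsupp z hz) (hτb z hz) 2 k (hcol k))

/-- **THE CONVEXITY LETTER ON A BOX WINDOW FROM FIBRE SUMS** (centre `0`).  `K` convex, `0 ∈ K`, `‖x‖_∞ ≤ ρ∞` on `K`; `A` symmetric
`σ`-coercive; `P ∈ C³` whose third-derivative entries have fibre sums `≤ M` ON `K` ⟹ `⟪·, A·⟫ + P` has the road's first-order letter ON `K`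
with modulus `2σ − (‖D²P(0)‖ + M·ρ∞)` — no `√n`, and `M` intensive as soon as `P` is local (§3). [folklore] -/
theorem firstOrderOn_quadratic_add_of_fibreSums (A : EuclideanSpace ℝ (Fin n) →L[ℝ] EuclideanSpace ℝ (Fin n))
    {σ M ρ : ℝ} {K : Set (EuclideanSpace ℝ (Fin n))} (hK : Convex ℝ K) (h0 : (0 : EuclideanSpace ℝ (Fin n)) ∈ K)
    (hKρ : ∀ x ∈ K, ‖WithLp.ofLp x‖ ≤ ρ)
    (hA : ∀ v w : EuclideanSpace ℝ (Fin n), ⟪A v, w⟫ = ⟪v, A w⟫) (hσ : ∀ v : EuclideanSpace ℝ (Fin n), σ * ‖v‖ ^ 2 ≤ ⟪v, A v⟫)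
    {P : EuclideanSpace ℝ (Fin n) → ℝ} (hP : ContDiff ℝ 3 P) (hM : 0 ≤ M)
    (hrow : ∀ z ∈ K, ∀ j : Fin n, ∑ r ∈ univ.filter (fun r : Fin 3 → Fin n => r 1 = j),
      |iteratedFDeriv ℝ 3 P z (fun s => EuclideanSpace.single (r s) (1 : ℝ))| ≤ M)
    (hcol : ∀ z ∈ K, ∀ k : Fin n, ∑ r ∈ univ.filter (fun r : Fin 3 → Fin n => r 2 = k),
      |iteratedFDeriv ℝ 3 P z (fun s => EuclideanSpace.single (r s) (1 : ℝ))| ≤ M) :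
    ∀ x ∈ K, ∀ y ∈ K, (⟪x, A x⟫ + P x) + ⟪gradient (fun z : EuclideanSpace ℝ (Fin n) => ⟪z, A z⟫ + P z) x, y - x⟫ +
        (2 * σ - (‖iteratedFDeriv ℝ 2 P 0‖ + M * ρ)) / 2 * ‖y - x‖ ^ 2 ≤ ⟪y, A y⟫ + P y :=
  firstOrderOn_quadratic_add_of_thirdDeriv_supNorm A hK h0 hKρ hA hσ hP hM (thirdDeriv_supNorm_of_fibreSums hM hrow hcol)

/-- **THE CONVEXITY LETTER OF A LOCAL PERTURBATION ON THE MODEL WINDOW `K = L ∩ box(x₀, a)`** — a linear subspace cut by the coordinate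
box of half-width `a ≥ 0` about `x₀ ∈ L`; `A` symmetric `σ`-coercive; `P ∈ C³` whose third-derivative entries ON `K` vanish off an interaction
set `N`, are bounded by `τ` on `N`, with at most `ν` triples through each middle ∕ last index ⟹ modulus `2σ − (‖D²P(x₀)‖ + ν·τ·a)` ON `K`.
Displayed: `σ`, the entry bound `τ`, the interaction count `ν`, the half-width `a`; everything structural is discharged. [folklore] -/
theorem firstOrderOn_quadratic_add_of_local_subspace_inter_coordBox
    (A : EuclideanSpace ℝ (Fin n) →L[ℝ] EuclideanSpace ℝ (Fin n)) (L : Submodule ℝ (EuclideanSpace ℝ (Fin n)))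
    {x₀ : EuclideanSpace ℝ (Fin n)} (hx₀ : x₀ ∈ L) {a σ τ : ℝ} {ν : ℕ} (ha : 0 ≤ a) (hτ : 0 ≤ τ)
    (hA : ∀ v w : EuclideanSpace ℝ (Fin n), ⟪A v, w⟫ = ⟪v, A w⟫) (hσ : ∀ v : EuclideanSpace ℝ (Fin n), σ * ‖v‖ ^ 2 ≤ ⟪v, A v⟫)
    {P : EuclideanSpace ℝ (Fin n) → ℝ} (hP : ContDiff ℝ 3 P) (N : Finset (Fin 3 → Fin n))
    (hsupp : ∀ z ∈ (L : Set (EuclideanSpace ℝ (Fin n))) ∩ {x | ∀ i : Fin n, |x i - x₀ i| ≤ a},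
      ∀ r, r ∉ N → iteratedFDeriv ℝ 3 P z (fun s => EuclideanSpace.single (r s) (1 : ℝ)) = 0)
    (hτb : ∀ z ∈ (L : Set (EuclideanSpace ℝ (Fin n))) ∩ {x | ∀ i : Fin n, |x i - x₀ i| ≤ a},
      ∀ r ∈ N, |iteratedFDeriv ℝ 3 P z (fun s => EuclideanSpace.single (r s) (1 : ℝ))| ≤ τ)
    (hrow : ∀ j : Fin n, (N.filter (fun r => r 1 = j)).card ≤ ν)
    (hcol : ∀ k : Fin n, (N.filter (fun r => r 2 = k)).card ≤ ν) :
    ∀ x ∈ (L : Set (EuclideanSpace ℝ (Fin n))) ∩ {x | ∀ i : Fin n, |x i - x₀ i| ≤ a},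
      ∀ y ∈ (L : Set (EuclideanSpace ℝ (Fin n))) ∩ {x | ∀ i : Fin n, |x i - x₀ i| ≤ a},
        (⟪x, A x⟫ + P x) + ⟪gradient (fun z : EuclideanSpace ℝ (Fin n) => ⟪z, A z⟫ + P z) x, y - x⟫ +
          (2 * σ - (‖iteratedFDeriv ℝ 2 P x₀‖ + ν * τ * a)) / 2 * ‖y - x‖ ^ 2 ≤ ⟪y, A y⟫ + P y :=
  firstOrderOn_quadratic_add_of_thirdDeriv_subspace_inter_coordBox A L hx₀ ha hA hσ hP (by positivity)
    (thirdDeriv_supNorm_of_local N hτ hsupp hτb hrow hcol)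

/-! ## §5 Block form: a decomposition of the identity, the block Schur test, the per-block reading (the desk's `c_latt` shape) -/

/-- **A `k`-LINEAR FORM OVER A BLOCK DECOMPOSITION**: for continuous linear maps `Q_b` with `Σ_b Q_b x = x` (a decomposition of the identity —
e.g. the orthogonal projections onto the bond blocks of the chart), `f m = Σ_{r : Fin k → B} f (Q_{r 0} m_0, …, Q_{r (k−1)} m_{k−1})`. [folklore] -/
theorem apply_eq_sum_blocks {k : ℕ} {B : Type*} [Fintype B] [DecidableEq B]
    (f : ContinuousMultilinearMap ℝ (fun _ : Fin k => EuclideanSpace ℝ (Fin n)) ℝ)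
    (Q : B → EuclideanSpace ℝ (Fin n) →L[ℝ] EuclideanSpace ℝ (Fin n))
    (hQ : ∀ x, ∑ b, Q b x = x) (m : Fin k → EuclideanSpace ℝ (Fin n)) :
    f m = ∑ r : Fin k → B, f (fun s => Q (r s) (m s)) := by
  have hm : m = fun s => ∑ b, Q b (m s) := funext fun s => (hQ (m s)).symm
  conv_lhs => rw [hm]
  rw [f.map_sum]

/-- **BLOCK FIBRE SUMS CONTROL THE WEIGHTED SQUARE SUM**: with Pythagoras `Σ_b ‖Q_b x‖² = ‖x‖²` for the decomposition, fibre sums of `T` over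
`{r | r s = b}` bounded by `M` give `Σ_r T r·‖Q_{r s} u‖² ≤ M·‖u‖²`. [folklore] -/
theorem sum_mul_normSq_le_of_blockFibreSum {B : Type*} [Fintype B] [DecidableEq B]
    (Q : B → EuclideanSpace ℝ (Fin n) →L[ℝ] EuclideanSpace ℝ (Fin n))
    (hQ2 : ∀ x, ∑ b, ‖Q b x‖ ^ 2 = ‖x‖ ^ 2)
    (T : (Fin 3 → B) → ℝ) (s : Fin 3) {M : ℝ}
    (hfib : ∀ b : B, ∑ r ∈ univ.filter (fun r : Fin 3 → B => r s = b), T r ≤ M)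
    (u : EuclideanSpace ℝ (Fin n)) :
    ∑ r : Fin 3 → B, T r * ‖Q (r s) u‖ ^ 2 ≤ M * ‖u‖ ^ 2 := by
  rw [← Finset.sum_fiberwise univ (fun r : Fin 3 → B => r s) (fun r => T r * ‖Q (r s) u‖ ^ 2)]
  rw [← hQ2 u, Finset.mul_sum]
  refine Finset.sum_le_sum fun b _ => ?_
  have hb : ∑ r ∈ univ.filter (fun r : Fin 3 → B => r s = b), T r * ‖Q (r s) u‖ ^ 2
      = (∑ r ∈ univ.filter (fun r : Fin 3 → B => r s = b), T r) * ‖Q b u‖ ^ 2 := by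
    rw [Finset.sum_mul]
    refine Finset.sum_congr rfl fun r hr => ?_
    rw [(Finset.mem_filter.1 hr).2]
  rw [hb]
  exact mul_le_mul_of_nonneg_right (hfib b) (sq_nonneg _)

/-- **THE BLOCK SCHUR TEST, TRILINEAR, BLOCK SUP NORM ON THE FIRST SLOT** (the desk's form, ρ-ne7bref-g74-1).  `Q_b` a decomposition of the
identity (`Σ_b Q_b = id`) by idempotents (`Q_b Q_b = Q_b`) with Pythagoras (`Σ_b ‖Q_b x‖² = ‖x‖²`) — e.g. the orthogonal projections onto the bond
blocks `ℝ³ ≅ su(2)` of the chart; `N` any reading dominating the block norms (`‖Q_b w‖ ≤ N w`, e.g. `N w = max_b ‖Q_b w‖`, T-61's per-bond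
reading); block entries `T r := ‖f ∘ (Q_{r 0}, Q_{r 1}, Q_{r 2})‖_op`.  If the fibre sums of `T` over the middle block index and over the last
block index are `≤ M` (`0 ≤ M`), then `|f(w, u, v)| ≤ M·N(w)·‖u‖·‖v‖`. [folklore] -/
theorem abs_apply_three_le_of_blockFibreSums {B : Type*} [Fintype B] [DecidableEq B]
    (f : ContinuousMultilinearMap ℝ (fun _ : Fin 3 => EuclideanSpace ℝ (Fin n)) ℝ)
    (Q : B → EuclideanSpace ℝ (Fin n) →L[ℝ] EuclideanSpace ℝ (Fin n))
    (hQ : ∀ x, ∑ b, Q b x = x) (hQ2 : ∀ x, ∑ b, ‖Q b x‖ ^ 2 = ‖x‖ ^ 2) (hidem : ∀ b x, Q b (Q b x) = Q b x)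
    (N : EuclideanSpace ℝ (Fin n) → ℝ) (hN : ∀ b w, ‖Q b w‖ ≤ N w) {M : ℝ} (hM : 0 ≤ M)
    (hrow : ∀ b : B, ∑ r ∈ univ.filter (fun r : Fin 3 → B => r 1 = b),
      ‖f.compContinuousLinearMap (fun s => Q (r s))‖ ≤ M)
    (hcol : ∀ b : B, ∑ r ∈ univ.filter (fun r : Fin 3 → B => r 2 = b),
      ‖f.compContinuousLinearMap (fun s => Q (r s))‖ ≤ M)
    (w u v : EuclideanSpace ℝ (Fin n)) :
    |f ![w, u, v]| ≤ M * N w * ‖u‖ * ‖v‖ := by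
  set T : (Fin 3 → B) → ℝ := fun r => ‖f.compContinuousLinearMap (fun s => Q (r s))‖ with hT
  have hT0 : ∀ r, 0 ≤ T r := fun r => norm_nonneg _
  -- each block term
  have hterm : ∀ r : Fin 3 → B,
      |f (fun s => Q (r s) (![w, u, v] s))| ≤ T r * (‖Q (r 0) w‖ * ‖Q (r 1) u‖ * ‖Q (r 2) v‖) := by
    intro r
    have happ : f (fun s => Q (r s) (![w, u, v] s))
        = (f.compContinuousLinearMap (fun s => Q (r s))) (fun s => Q (r s) (![w, u, v] s)) := by
      rw [ContinuousMultilinearMap.compContinuousLinearMap_apply]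
      simp only [hidem]
    rw [happ]
    have hop := (f.compContinuousLinearMap (fun s => Q (r s))).le_opNorm (fun s => Q (r s) (![w, u, v] s))
    rw [Real.norm_eq_abs] at hop
    refine hop.trans (le_of_eq ?_)
    simp [Fin.prod_univ_three, hT, mul_assoc]
  have h1 : |f ![w, u, v]| ≤ N w * ∑ r : Fin 3 → B, T r * ‖Q (r 1) u‖ * ‖Q (r 2) v‖ := by
    rw [apply_eq_sum_blocks f Q hQ ![w, u, v]]
    calc |∑ r : Fin 3 → B, f (fun s => Q (r s) (![w, u, v] s))|
        ≤ ∑ r : Fin 3 → B, |f (fun s => Q (r s) (![w, u, v] s))| := Finset.abs_sum_le_sum_abs _ _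
      _ ≤ ∑ r : Fin 3 → B, T r * (‖Q (r 0) w‖ * ‖Q (r 1) u‖ * ‖Q (r 2) v‖) := Finset.sum_le_sum fun r _ => hterm r
      _ = ∑ r : Fin 3 → B, ‖Q (r 0) w‖ * (T r * ‖Q (r 1) u‖ * ‖Q (r 2) v‖) :=
          Finset.sum_congr rfl fun r _ => by ring
      _ ≤ ∑ r : Fin 3 → B, N w * (T r * ‖Q (r 1) u‖ * ‖Q (r 2) v‖) := by
          refine Finset.sum_le_sum fun r _ => ?_
          exact mul_le_mul_of_nonneg_right (hN (r 0) w) (by positivity)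
      _ = N w * ∑ r : Fin 3 → B, T r * ‖Q (r 1) u‖ * ‖Q (r 2) v‖ := by rw [Finset.mul_sum]
  have h2 : ∑ r : Fin 3 → B, T r * ‖Q (r 1) u‖ * ‖Q (r 2) v‖ ≤ M * (‖u‖ * ‖v‖) :=
    sum_mul_mul_le_of_sq_sums _ _ _ _ hT0 hM (norm_nonneg _) (norm_nonneg _)
      (sum_mul_normSq_le_of_blockFibreSum Q hQ2 T 1 hrow u) (sum_mul_normSq_le_of_blockFibreSum Q hQ2 T 2 hcol v)
  rcases isEmpty_or_nonempty B with hB | hB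
  · -- no blocks at all: `u = Σ_b Q_b u = 0`, both sides vanish
    have hu : u = 0 := by simpa using (hQ u).symm
    have hz : f ![w, u, v] = 0 := f.map_coord_zero 1 (by simp [hu])
    rw [hz, hu, abs_zero, norm_zero]
    simp
  · obtain ⟨b⟩ := hB
    have hNw : 0 ≤ N w := (norm_nonneg _).trans (hN b w)
    calc |f ![w, u, v]| ≤ N w * ∑ r : Fin 3 → B, T r * ‖Q (r 1) u‖ * ‖Q (r 2) v‖ := h1
      _ ≤ N w * (M * (‖u‖ * ‖v‖)) := mul_le_mul_of_nonneg_left h2 hNw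
      _ = M * N w * ‖u‖ * ‖v‖ := by ring

/-- **THE MIXED LETTER IN A BLOCK READING FROM BLOCK FIBRE SUMS** (`c = M`).  Under the block Schur hypotheses ON `K` for
`f = D³P(z)`, with `0 ≤ N`: `‖D³P(z)[w,·,·]‖_op ≤ M·N(w)` for `z ∈ K` — the `N`-letter of `…ConvexWindowSuppliersBox` §1–§2. [folklore] -/
theorem thirdDeriv_reading_of_blockFibreSums {B : Type*} [Fintype B] [DecidableEq B] {P : EuclideanSpace ℝ (Fin n) → ℝ}
    {K : Set (EuclideanSpace ℝ (Fin n))} (Q : B → EuclideanSpace ℝ (Fin n) →L[ℝ] EuclideanSpace ℝ (Fin n))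
    (hQ : ∀ x, ∑ b, Q b x = x) (hQ2 : ∀ x, ∑ b, ‖Q b x‖ ^ 2 = ‖x‖ ^ 2) (hidem : ∀ b x, Q b (Q b x) = Q b x)
    (N : EuclideanSpace ℝ (Fin n) → ℝ) (hN : ∀ b w, ‖Q b w‖ ≤ N w) (hN0 : ∀ w, 0 ≤ N w) {M : ℝ} (hM : 0 ≤ M)
    (hrow : ∀ z ∈ K, ∀ b : B, ∑ r ∈ univ.filter (fun r : Fin 3 → B => r 1 = b),
      ‖(iteratedFDeriv ℝ 3 P z).compContinuousLinearMap (fun s => Q (r s))‖ ≤ M)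
    (hcol : ∀ z ∈ K, ∀ b : B, ∑ r ∈ univ.filter (fun r : Fin 3 → B => r 2 = b),
      ‖(iteratedFDeriv ℝ 3 P z).compContinuousLinearMap (fun s => Q (r s))‖ ≤ M) :
    ∀ z ∈ K, ∀ w : EuclideanSpace ℝ (Fin n), ‖fderiv ℝ (iteratedFDeriv ℝ 2 P) z w‖ ≤ M * N w :=
  thirdDeriv_reading_of_entries N hN0 hM fun z hz w u v =>
    abs_apply_three_le_of_blockFibreSums (iteratedFDeriv ℝ 3 P z) Q hQ hQ2 hidem N hN hM (hrow z hz) (hcol z hz) w u v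

/-- **THE CONVEXITY LETTER ON A BLOCK-READ WINDOW FROM BLOCK FIBRE SUMS, ANY CENTRE.**  `K` convex, `x₀ ∈ K`, `N(x − x₀) ≤ ρ` on `K` for a
reading `N ≥ 0` dominating the block norms of a decomposition `Q` (T-61's window `⋂_b {‖y_b‖ < a_b}` is such a `K` with `ρ = max_b a_b`);
`A` symmetric `σ`-coercive; `P ∈ C³` whose third derivative has block fibre sums `≤ M` ON `K` ⟹ modulus `2σ − (‖D²P(x₀)‖ + M·ρ)` ON `K` — the
desk's `c_latt`-shape constant times the per-block radius, no `√n` and no bond-dimension factor. [folklore] -/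
theorem firstOrderOn_quadratic_add_of_blockFibreSums {B : Type*} [Fintype B] [DecidableEq B]
    (A : EuclideanSpace ℝ (Fin n) →L[ℝ] EuclideanSpace ℝ (Fin n))
    (Q : B → EuclideanSpace ℝ (Fin n) →L[ℝ] EuclideanSpace ℝ (Fin n))
    (hQ : ∀ x, ∑ b, Q b x = x) (hQ2 : ∀ x, ∑ b, ‖Q b x‖ ^ 2 = ‖x‖ ^ 2) (hidem : ∀ b x, Q b (Q b x) = Q b x)
    (N : EuclideanSpace ℝ (Fin n) → ℝ) (hN : ∀ b w, ‖Q b w‖ ≤ N w) (hN0 : ∀ w, 0 ≤ N w)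
    {σ M ρ : ℝ} {K : Set (EuclideanSpace ℝ (Fin n))} (hK : Convex ℝ K) {x₀ : EuclideanSpace ℝ (Fin n)} (hx₀ : x₀ ∈ K)
    (hKρ : ∀ x ∈ K, N (x - x₀) ≤ ρ)
    (hA : ∀ v w : EuclideanSpace ℝ (Fin n), ⟪A v, w⟫ = ⟪v, A w⟫) (hσ : ∀ v : EuclideanSpace ℝ (Fin n), σ * ‖v‖ ^ 2 ≤ ⟪v, A v⟫)
    {P : EuclideanSpace ℝ (Fin n) → ℝ} (hP : ContDiff ℝ 3 P) (hM : 0 ≤ M)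
    (hrow : ∀ z ∈ K, ∀ b : B, ∑ r ∈ univ.filter (fun r : Fin 3 → B => r 1 = b),
      ‖(iteratedFDeriv ℝ 3 P z).compContinuousLinearMap (fun s => Q (r s))‖ ≤ M)
    (hcol : ∀ z ∈ K, ∀ b : B, ∑ r ∈ univ.filter (fun r : Fin 3 → B => r 2 = b),
      ‖(iteratedFDeriv ℝ 3 P z).compContinuousLinearMap (fun s => Q (r s))‖ ≤ M) :
    ∀ x ∈ K, ∀ y ∈ K, (⟪x, A x⟫ + P x) + ⟪gradient (fun z : EuclideanSpace ℝ (Fin n) => ⟪z, A z⟫ + P z) x, y - x⟫ +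
        (2 * σ - (‖iteratedFDeriv ℝ 2 P x₀‖ + M * ρ)) / 2 * ‖y - x‖ ^ 2 ≤ ⟪y, A y⟫ + P y :=
  firstOrderOn_quadratic_add_of_thirdDeriv_reading A N hK hx₀ hKρ hA hσ hP hM
    (thirdDeriv_reading_of_blockFibreSums Q hQ hQ2 hidem N hN hN0 hM hrow hcol)

/-- **THE END ON T-61's WINDOW FROM THE BLOCK SCHUR LETTER** — `K = L ∩ ⋂_b {‖Q_b y‖ ≤ a}` (per-block balls of radius `a ≥ 0` cut by a
linear subspace), `Q_b` a decomposition of the identity by idempotents with Pythagoras, `A` symmetric `σ`-coercive, `P ∈ C³` whose third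
derivative has block fibre sums `≤ M` ON `K` ⟹ modulus `2σ − (‖D²P(0)‖ + M·a)` ON `K`: PER-BLOCK radius times the block Schur constant (for the
Wilson cubic the desk's `c_latt`-shape `6·3√3`), nothing else displayed; no `√n`, no block-dimension factor. [folklore] -/
theorem firstOrderOn_quadratic_add_of_blockFibreSums_blockWindow {B : Type*} [Fintype B] [DecidableEq B] [Nonempty B]
    (A : EuclideanSpace ℝ (Fin n) →L[ℝ] EuclideanSpace ℝ (Fin n))
    (Q : B → EuclideanSpace ℝ (Fin n) →L[ℝ] EuclideanSpace ℝ (Fin n))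
    (hQ : ∀ x, ∑ b, Q b x = x) (hQ2 : ∀ x, ∑ b, ‖Q b x‖ ^ 2 = ‖x‖ ^ 2) (hidem : ∀ b x, Q b (Q b x) = Q b x)
    (L : Submodule ℝ (EuclideanSpace ℝ (Fin n))) {a σ M : ℝ} (ha : 0 ≤ a)
    (hA : ∀ v w : EuclideanSpace ℝ (Fin n), ⟪A v, w⟫ = ⟪v, A w⟫) (hσ : ∀ v : EuclideanSpace ℝ (Fin n), σ * ‖v‖ ^ 2 ≤ ⟪v, A v⟫)
    {P : EuclideanSpace ℝ (Fin n) → ℝ} (hP : ContDiff ℝ 3 P) (hM : 0 ≤ M)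
    (hrow : ∀ z ∈ (L : Set (EuclideanSpace ℝ (Fin n))) ∩ {y | ∀ b, ‖Q b y‖ ≤ a}, ∀ b : B,
      ∑ r ∈ univ.filter (fun r : Fin 3 → B => r 1 = b), ‖(iteratedFDeriv ℝ 3 P z).compContinuousLinearMap (fun s => Q (r s))‖ ≤ M)
    (hcol : ∀ z ∈ (L : Set (EuclideanSpace ℝ (Fin n))) ∩ {y | ∀ b, ‖Q b y‖ ≤ a}, ∀ b : B,
      ∑ r ∈ univ.filter (fun r : Fin 3 → B => r 2 = b), ‖(iteratedFDeriv ℝ 3 P z).compContinuousLinearMap (fun s => Q (r s))‖ ≤ M) :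
    ∀ x ∈ (L : Set (EuclideanSpace ℝ (Fin n))) ∩ {y | ∀ b, ‖Q b y‖ ≤ a},
      ∀ y ∈ (L : Set (EuclideanSpace ℝ (Fin n))) ∩ {y | ∀ b, ‖Q b y‖ ≤ a},
        (⟪x, A x⟫ + P x) + ⟪gradient (fun z : EuclideanSpace ℝ (Fin n) => ⟪z, A z⟫ + P z) x, y - x⟫ +
          (2 * σ - (‖iteratedFDeriv ℝ 2 P 0‖ + M * a)) / 2 * ‖y - x‖ ^ 2 ≤ ⟪y, A y⟫ + P y :=
  firstOrderOn_quadratic_add_of_thirdDeriv_subspace_inter_blockWindow A Q L ha hA hσ hP hM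
    (thirdDeriv_reading_of_blockFibreSums Q hQ hQ2 hidem (fun w => ⨆ b, ‖Q b w‖) (fun b w => norm_block_le_iSup Q w b)
      (fun w => (norm_nonneg _).trans (norm_block_le_iSup Q w (Classical.arbitrary B))) hM hrow hcol)

end Summit.QuantumFields.BalabanUV.T4Continuum.NE7b.ConvexWindowSuppliersLocal

end
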